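import Mathlib
import HarnessLib
import Summits.NavierStokesRegularity.NavierStokesRegularity.Theorems.PoloidalWindowDoorPoloidalWindowRigidityTimeShear
import Summits.NavierStokesRegularity.NavierStokesRegularity.Theorems.PoloidalWindowDoorPoloidalWindowRigiditySeparatedPressure

/-!
# Route `PoloidalWindowDoor`, crux `PoloidalWindowRigidity` (K2, stmt-NavierStokesRegularity-19708) — the stratum (TV)
# «TIME-DEPENDENT PROPORTIONAL SHEAR»: normal form with an analytic slope function, and its PRESSURE LAW
# `∇_h f₂ = (μ′/(1−μ)) ∇_h v₂ = ∂₂ f_h` (the separated pressure of p475636 acquires exactly one new term)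

Cell ns-regularity-ideate, seat ns-poloidal-K2-p3 gen 4 (stub-worker under the K2 lead ns-poloidal-K2-p1; file landed
`--supports stmt-NavierStokesRegularity-19708` as a helper).

`…TimeShear.timeShear_of_local` reduced the complement of LRC″'s spatial pins («shear slope a function of time only on
some open space–time set») to: `v ≡ 0`, or EVERY slice `s < 0` is proportional-shear with a negative slope `μ_s`.  Here:

* `timeShear_normalForm` — the same with ONE slope FUNCTION `μ : ℝ → ℝ`, negative and REAL-ANALYTIC at every `s < 0`
  (in the non-trivial branch every slice carries a point with `∇_h v₂ ≠ 0`, else it is flat and nsreg-p7's p509055 ends;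
  there `μ` is the analytic ratio of `…TimeShear.analyticAt_sliceSlope`).
* `timeShear_pressure` — **the pressure law of (TV)**: class + poloidal + `∂₂v_b(s,·) ≡ μ(s) ∂_b v₂(s,·)` (`b = 0,1`,
  all `s < 0`) with `μ` differentiable at `t`, `μ(t) ≠ 1` ⇒ for the intrinsic residual `f = ∂ₜv + (v·∇)v − Δv`
  (`= −∇p` on classical windows): **`(∂_b f)₂ = (∂₂ f)_b = μ′(t)/(1 − μ(t)) · ∂_b v₂`** at every point of the slice
  (`b = 0,1`).  For `μ′ = 0` this is ns-poloidal-K2-p3 g2's `separatedPressure_of_clebschSlope` (p475636, `∇_h f₂ ≡ 0`,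
  the input of ns-poloidal-K2-p2's M12 chain p511024); for `μ′ ≠ 0` the vertical residual is NOT height-only:
  `f₂ − (μ′/(1−μ)) v₂` is (i.e. `∂₂p = (h′(t,x₂) − μ′v₂)/(1−μ)`).  Proof = p475636's, applying `L = ∂ₜ + v·∇ − Δ` to the
  constraint `∂₂v_b = μ(t)∂_b v₂`: the product rule in time contributes the one extra term `μ′ ∂_b v₂`.
* `timeShear_pressure_weighted` — the same law for the Clebsch stream-function weight: with `ψ := (1 − μ(t)) v₂`
  (so that `∇_h ψ = J ω_h`), `(1 − μ)(∂_b f)₂ − μ′ ∂_b v₂ = 0`, the form in which M12's variance law should be re-run.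

So the located residual of the lrc-jet dichotomy with spatial pins is exactly: «(TV) with `μ′ ≢ 0` is empty in the
class» — p511024's argument with the source term `2μ′/(1−μ)·V` in the horizontal-variance law (equivalently, run on `ψ`).
MODEL data point (not NS-in-the-class): linear flows `v = D_{μ(t)}Q(t)x` (`tr = 0`, one ODE) realise (TV) locally with
`μ′ ≠ 0` — with spatially constant vorticity, hence symmetric — so (TV)-JETS exist and the exclusion must be global ((M)).

WHAT THIS IS NOT: not a claim about Navier–Stokes regularity and not LRC″ — structure theorems for one located stratum
(bears_on LADDER-NS N0 via crux K2 = stmt-19708).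
-/

noncomputable section

-- the summit and its single sub-problem share the name (CONVENTIONS §1), as in every Theorems file
set_option linter.dupNamespace false

namespace Summit.NavierStokesRegularity.NavierStokesRegularity.Theorems.PoloidalWindowDoorPoloidalWindowRigidityTimeShearPressure

open MeasureTheory Set Function Filter Topology TopologicalSpace Metric InnerProductSpace
open scoped RealInnerProductSpace InnerProductSpace Laplacian ContDiff
open Literature.Analysis Literature.Analysis.FluidPDE
open Summit.NavierStokesRegularity.NavierStokesRegularity.Theorems.LocalSineTubeDoorProfileAlignedWindowRigidityAncient
open Summit.NavierStokesRegularity.NavierStokesRegularity.Theorems.TubeAlternative.AnalyticPropagation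
open Summit.NavierStokesRegularity.NavierStokesRegularity.Theorems.PoloidalWindowDoorPoloidalWindowRigidityWindow
open Summit.NavierStokesRegularity.NavierStokesRegularity.Theorems.PoloidalWindowDoorPoloidalWindowRigidityVelocityGradientLaw
open Summit.NavierStokesRegularity.NavierStokesRegularity.Theorems.PoloidalWindowDoorPoloidalWindowRigiditySeparatedPressure
open Summit.NavierStokesRegularity.NavierStokesRegularity.Theorems.PoloidalWindowDoorPoloidalWindowRigiditySymmetryGerms
open Summit.NavierStokesRegularity.NavierStokesRegularity.Theorems.PoloidalWindowDoorPoloidalWindowRigidityK2OfLrcSlope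
open Summit.NavierStokesRegularity.NavierStokesRegularity.Theorems.PoloidalWindowDoorPoloidalWindowRigidityTimeShear

variable {C : ℝ} {v : ℝ → EuclideanSpace ℝ (Fin 3) → EuclideanSpace ℝ (Fin 3)}

/-! ### Normal form: one analytic negative slope function -/

/-- **(TV) NORMAL FORM.**  Class + poloidal + «the shear slope is a function of time only on some nonempty open
space–time set» ⇒ EITHER `v ≡ 0` OR there is ONE function `μ : ℝ → ℝ`, negative and real-analytic at every `s < 0`,
with `∂₂v_b(s,y) = μ(s) ∂_b v₂(s,y)` for all `s < 0`, `y`, `b = 0,1`. -/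
theorem timeShear_normalForm (hrate : HasTypeITimeDecay C v)
    (hcont : ContinuousOn (uncurry v) (Iio (0 : ℝ) ×ˢ univ))
    (hmild : ∀ s t : ℝ, s < t → t < 0 → ∀ x,
      v t x = UnboundedOperators.heatExtension (v s) (t - s) x - oseenDuhamel 1 s v v t x)
    (hdiv : ∀ t < 0, VectorCalculus.IsDivFree (v t))
    (hpol : ∀ s < 0, ∀ y, ⟪curl (v s) y, EuclideanSpace.single 2 1⟫_ℝ = 0)
    {W : Set (ℝ × EuclideanSpace ℝ (Fin 3))} (hW : IsOpen W) (hWne : W.Nonempty) (hWs : W ⊆ Iio (0 : ℝ) ×ˢ univ)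
    {m : ℝ → ℝ}
    (h : ∀ z ∈ W, ∀ b : Fin 3, b ≠ 2 →
      fderiv ℝ (v z.1) z.2 (EuclideanSpace.single 2 1) b = m z.1 * fderiv ℝ (v z.1) z.2 (EuclideanSpace.single b 1) 2) :
    (∀ t < 0, ∀ x, v t x = 0) ∨
      ∃ μ : ℝ → ℝ, (∀ s < 0, μ s < 0) ∧ (∀ s < 0, AnalyticAt ℝ μ s) ∧
        ∀ s < 0, ∀ y, ∀ b : Fin 3, b ≠ 2 →
          fderiv ℝ (v s) y (EuclideanSpace.single 2 1) b = μ s * fderiv ℝ (v s) y (EuclideanSpace.single b 1) 2 := by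
  by_cases hv : ∀ t < 0, ∀ x, v t x = 0
  · exact Or.inl hv
  rcases timeShear_of_local hrate hcont hmild hdiv hpol hW hWne hWs h with hzero | hall
  · exact Or.inl hzero
  right
  choose! μ hμneg hμid using hall
  refine ⟨μ, hμneg, fun s₀ hs₀ => ?_, hμid⟩
  -- the slice `s₀` carries a point with `∇_h v₂ ≠ 0` (else it is flat and `v ≡ 0`)
  have hnd : ∃ (y₀ : EuclideanSpace ℝ (Fin 3)) (b₀ : Fin 3), b₀ ≠ 2 ∧
      fderiv ℝ (v s₀) y₀ (EuclideanSpace.single b₀ 1) 2 ≠ 0 := by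
    by_contra hcon
    push Not at hcon
    exact hv (eq_zero_of_horizontalGradient_eq_zero_on_open hrate hcont hmild hdiv hs₀ (hpol s₀ hs₀) isOpen_univ
      univ_nonempty fun y _ => hcon y 0 (by decide))
  obtain ⟨y₀, b₀, hb₀, hne⟩ := hnd
  exact analyticAt_sliceSlope hrate hcont hmild hμid hs₀ hb₀ hne

/-! ### The pressure law of time-dependent proportional shear -/

/-- **THE PRESSURE LAW OF (TV).**  Let `v` be a profile of the route's Type-I class, poloidal along `e₃`, with
`∂₂v_b(s,·) ≡ μ(s) ∂_b v₂(s,·)` (`b = 0,1`) on every slice `s < 0`, where `μ` has derivative `μ′` at `t < 0` and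
`μ(t) ≠ 1`.  Then for the intrinsic residual `f = ∂ₜv + (v·∇)v − Δv` and `b = 0,1`:
`(∂_b f)₂(t,x) = μ′/(1 − μ(t)) · ∂_b v₂(t,x)` and `(∂₂ f)_b(t,x) = μ′/(1 − μ(t)) · ∂_b v₂(t,x)`. -/
theorem timeShear_pressure (hrate : HasTypeITimeDecay C v)
    (hcont : ContinuousOn (uncurry v) (Iio (0 : ℝ) ×ˢ univ))
    (hmild : ∀ s t : ℝ, s < t → t < 0 → ∀ x,
      v t x = UnboundedOperators.heatExtension (v s) (t - s) x - oseenDuhamel 1 s v v t x)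
    (hdiv : ∀ t < 0, VectorCalculus.IsDivFree (v t))
    (hpol : ∀ s < 0, ∀ y, ⟪curl (v s) y, EuclideanSpace.single 2 1⟫_ℝ = 0) {μ : ℝ → ℝ} {μ' t : ℝ} (ht : t < 0)
    (hslope : ∀ s < 0, ∀ y, ∀ b : Fin 3, b ≠ 2 →
      fderiv ℝ (v s) y (EuclideanSpace.single 2 1) b = μ s * fderiv ℝ (v s) y (EuclideanSpace.single b 1) 2)
    (hμd : HasDerivAt μ μ' t) (hμ1 : μ t ≠ 1) (x : EuclideanSpace ℝ (Fin 3)) {b : Fin 3} (hb : b ≠ 2) :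
    fderiv ℝ (fun y => timeDerivWithin (Iio 0) v t y + convect (v t) (v t) y - Δ (v t) y) x
          (EuclideanSpace.single b 1) 2 = μ' / (1 - μ t) * fderiv ℝ (v t) x (EuclideanSpace.single b 1) 2 ∧
      fderiv ℝ (fun y => timeDerivWithin (Iio 0) v t y + convect (v t) (v t) y - Δ (v t) y) x
          (EuclideanSpace.single 2 1) b = μ' / (1 - μ t) * fderiv ℝ (v t) x (EuclideanSpace.single b 1) 2 := by
  have hA : IsTypeIAncientMild C v := isTypeIAncientMild_of_class hrate hcont hmild hdiv
  have hs : ContDiff ℝ ∞ (v t) := hA.contDiff_slice ht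
  have hb' : b = 0 ∨ b = 1 := by
    fin_cases b <;> simp at hb ⊢
  -- ## the two laws (`e₃`-derivative of `v_b`, `e_b`-derivative of `v₂`) and `curl f = 0`
  have hL3 := fderiv_equation_coord hrate hcont hmild hdiv ht x (EuclideanSpace.single 2 1) b
  have hLb := fderiv_equation_coord hrate hcont hmild hdiv ht x (EuclideanSpace.single b 1) 2
  rw [apply_apply_coord] at hL3 hLb
  obtain ⟨hc0, hc1⟩ := fderiv_residual_symm hrate hcont hmild hdiv ht x
  -- ## the constrained scalar `∂₂v_b = μ(s) ∂_b v₂` near `t` and on the slice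
  have hfun_t : (fun s => fderiv ℝ (v s) x (EuclideanSpace.single 2 1) b) =ᶠ[𝓝 t]
      fun s => μ s * fderiv ℝ (v s) x (EuclideanSpace.single b 1) 2 := by
    filter_upwards [Iio_mem_nhds ht] with s hs' using hslope s hs' x b hb
  have hfun_x : (fun y => fderiv ℝ (v t) y (EuclideanSpace.single 2 1) b) =
      fun y => μ t * fderiv ℝ (v t) y (EuclideanSpace.single b 1) 2 := funext fun y => hslope t ht y b hb
  have hg : ContDiff ℝ ∞ (fun y => fderiv ℝ (v t) y (EuclideanSpace.single b 1) 2) := by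
    have h1 : ContDiff ℝ ∞ (fun y => fderiv ℝ (v t) y (EuclideanSpace.single b 1)) :=
      (hs.fderiv_right (m := ∞) (by norm_cast)).clm_apply contDiff_const
    exact (EuclideanSpace.proj (𝕜 := ℝ) (2 : Fin 3) : EuclideanSpace ℝ (Fin 3) →L[ℝ] ℝ).contDiff.comp h1
  -- differentiability in time of `s ↦ ∂_b v₂(s,x)` (joint analyticity of the Jacobian entries)
  have hgt : DifferentiableAt ℝ (fun s => fderiv ℝ (v s) x (EuclideanSpace.single b 1) 2) t := by
    have hmem : ((t, x) : ℝ × EuclideanSpace ℝ (Fin 3)) ∈ Iio (0 : ℝ) ×ˢ (univ : Set (EuclideanSpace ℝ (Fin 3))) :=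
      mk_mem_prod ht (mem_univ _)
    have hline : AnalyticAt ℝ (fun s : ℝ => ((s, x) : ℝ × EuclideanSpace ℝ (Fin 3))) t :=
      analyticAt_id.prod analyticAt_const
    have han := (analyticOnNhd_uncurry_fderiv_entry hrate hcont hmild b 2 (t, x) hmem).comp
      (f := fun s : ℝ => ((s, x) : ℝ × EuclideanSpace ℝ (Fin 3))) hline
    have han' : AnalyticAt ℝ (fun s => fderiv ℝ (v s) x (EuclideanSpace.single b 1) 2) t := by
      simpa [Function.comp_def] using han
    exact han'.differentiableAt
  have hT : deriv (fun s => fderiv ℝ (v s) x (EuclideanSpace.single 2 1) b) t =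
      μ' * fderiv ℝ (v t) x (EuclideanSpace.single b 1) 2 +
        μ t * deriv (fun s => fderiv ℝ (v s) x (EuclideanSpace.single b 1) 2) t := by
    rw [hfun_t.deriv_eq]
    exact (hμd.mul hgt.hasDerivAt).deriv
  have hX : fderiv ℝ (fun y => fderiv ℝ (v t) y (EuclideanSpace.single 2 1) b) x (v t x) =
      μ t * fderiv ℝ (fun y => fderiv ℝ (v t) y (EuclideanSpace.single b 1) 2) x (v t x) := by
    rw [hfun_x, fderiv_const_mul ((hg.differentiable (by simp)) x), smul_apply, smul_eq_mul]
  have hΔ : Δ (fun y => fderiv ℝ (v t) y (EuclideanSpace.single 2 1) b) x =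
      μ t * Δ (fun y => fderiv ℝ (v t) y (EuclideanSpace.single b 1) 2) x := by
    rw [hfun_x]
    have hfun : (fun y => μ t * fderiv ℝ (v t) y (EuclideanSpace.single b 1) 2) =
        μ t • fun y => fderiv ℝ (v t) y (EuclideanSpace.single b 1) 2 := by
      funext y; simp
    rw [hfun, InnerProductSpace.laplacian_smul (μ t) (hg.contDiffAt.of_le (by norm_cast)), smul_eq_mul]
  -- ## subtract the two laws: `μ((∂_b f)₂ − (Dv ∂_b v)₂) + μ′ ∂_b v₂ = (∂₂f)_b − (Dv ∂₂v)_b`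
  have hstar : μ t * (fderiv ℝ (fun y => timeDerivWithin (Iio 0) v t y + convect (v t) (v t) y - Δ (v t) y) x
        (EuclideanSpace.single b 1) 2 -
        ∑ j : Fin 3, fderiv ℝ (v t) x (EuclideanSpace.single b 1) j *
          fderiv ℝ (v t) x (EuclideanSpace.single j 1) 2) +
        μ' * fderiv ℝ (v t) x (EuclideanSpace.single b 1) 2 =
      fderiv ℝ (fun y => timeDerivWithin (Iio 0) v t y + convect (v t) (v t) y - Δ (v t) y) x
        (EuclideanSpace.single 2 1) b -
        ∑ j : Fin 3, fderiv ℝ (v t) x (EuclideanSpace.single 2 1) j *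
          fderiv ℝ (v t) x (EuclideanSpace.single j 1) b := by
    rw [← hLb, ← hL3, hT, hX, hΔ]
    ring
  -- ## the pointwise inputs: the slope at `(t,x)`, `∂₀v₁ = ∂₁v₀`
  have h20 : fderiv ℝ (v t) x (EuclideanSpace.single 2 1) 0 = μ t * fderiv ℝ (v t) x (EuclideanSpace.single 0 1) 2 :=
    hslope t ht x 0 (by decide)
  have h21 : fderiv ℝ (v t) x (EuclideanSpace.single 2 1) 1 = μ t * fderiv ℝ (v t) x (EuclideanSpace.single 1 1) 2 :=
    hslope t ht x 1 (by decide)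
  have hω2 : curl (v t) x 2 = 0 := by simpa [EuclideanSpace.inner_single_right] using hpol t ht x
  have hsym : fderiv ℝ (v t) x (EuclideanSpace.single 0 1) 1 = fderiv ℝ (v t) x (EuclideanSpace.single 1 1) 0 := by
    have h : fderiv ℝ (v t) x (EuclideanSpace.single 0 1) 1 - fderiv ℝ (v t) x (EuclideanSpace.single 1 1) 0 = 0 := by
      simpa [curl] using hω2
    linarith
  have hne : (1 : ℝ) - μ t ≠ 0 := sub_ne_zero.2 (Ne.symm hμ1)
  -- name the nine gradient entries and the four residual derivatives
  obtain ⟨D, hD⟩ : ∃ D : EuclideanSpace ℝ (Fin 3) →L[ℝ] EuclideanSpace ℝ (Fin 3), fderiv ℝ (v t) x = D := ⟨_, rfl⟩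
  obtain ⟨G, hG⟩ : ∃ G : EuclideanSpace ℝ (Fin 3) →L[ℝ] EuclideanSpace ℝ (Fin 3),
      fderiv ℝ (fun y => timeDerivWithin (Iio 0) v t y + convect (v t) (v t) y - Δ (v t) y) x = G := ⟨_, rfl⟩
  rw [hD] at hstar h20 h21 hsym
  rw [hG] at hstar hc0 hc1 ⊢
  rw [hD]
  rcases hb' with rfl | rfl
  · simp only [Fin.sum_univ_three] at hstar
    have h1 : (μ t - 1) * G (EuclideanSpace.single 0 1) 2 + μ' * D (EuclideanSpace.single 0 1) 2 = 0 := by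
      linear_combination hstar - hc0 - (D (EuclideanSpace.single 0 1) 0 + D (EuclideanSpace.single 2 1) 2) * h20
        - D (EuclideanSpace.single 1 1) 0 * h21 + μ t * D (EuclideanSpace.single 1 1) 2 * hsym
    have h2 : G (EuclideanSpace.single 0 1) 2 = μ' / (1 - μ t) * D (EuclideanSpace.single 0 1) 2 := by
      rw [div_mul_eq_mul_div, eq_div_iff hne]
      linear_combination -h1
    exact ⟨h2, by rw [← hc0, h2]⟩
  · simp only [Fin.sum_univ_three] at hstar
    have h1 : (μ t - 1) * G (EuclideanSpace.single 1 1) 2 + μ' * D (EuclideanSpace.single 1 1) 2 = 0 := by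
      linear_combination hstar - hc1 - D (EuclideanSpace.single 0 1) 1 * h20
        - (D (EuclideanSpace.single 1 1) 1 + D (EuclideanSpace.single 2 1) 2) * h21
        - μ t * D (EuclideanSpace.single 0 1) 2 * hsym
    have h2 : G (EuclideanSpace.single 1 1) 2 = μ' / (1 - μ t) * D (EuclideanSpace.single 1 1) 2 := by
      rw [div_mul_eq_mul_div, eq_div_iff hne]
      linear_combination -h1
    exact ⟨h2, by rw [← hc1, h2]⟩

/-- **The pressure law of (TV), weighted form.**  In the situation of `timeShear_pressure`:
`(1 − μ(t)) (∂_b f)₂ − μ′ ∂_b v₂ = 0` (`b = 0,1`), i.e. `∇_h[(1−μ) f₂ − μ′ v₂] = 0` — with `f = −∇p` on windows,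
`(1 − μ)∂₂p + μ′ v₂` depends on `(t, x₂)` only. -/
theorem timeShear_pressure_weighted (hrate : HasTypeITimeDecay C v)
    (hcont : ContinuousOn (uncurry v) (Iio (0 : ℝ) ×ˢ univ))
    (hmild : ∀ s t : ℝ, s < t → t < 0 → ∀ x,
      v t x = UnboundedOperators.heatExtension (v s) (t - s) x - oseenDuhamel 1 s v v t x)
    (hdiv : ∀ t < 0, VectorCalculus.IsDivFree (v t))
    (hpol : ∀ s < 0, ∀ y, ⟪curl (v s) y, EuclideanSpace.single 2 1⟫_ℝ = 0) {μ : ℝ → ℝ} {μ' t : ℝ} (ht : t < 0)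
    (hslope : ∀ s < 0, ∀ y, ∀ b : Fin 3, b ≠ 2 →
      fderiv ℝ (v s) y (EuclideanSpace.single 2 1) b = μ s * fderiv ℝ (v s) y (EuclideanSpace.single b 1) 2)
    (hμd : HasDerivAt μ μ' t) (hμ1 : μ t ≠ 1) (x : EuclideanSpace ℝ (Fin 3)) {b : Fin 3} (hb : b ≠ 2) :
    (1 - μ t) * fderiv ℝ (fun y => timeDerivWithin (Iio 0) v t y + convect (v t) (v t) y - Δ (v t) y) x
          (EuclideanSpace.single b 1) 2 - μ' * fderiv ℝ (v t) x (EuclideanSpace.single b 1) 2 = 0 := by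
  have hne : (1 : ℝ) - μ t ≠ 0 := sub_ne_zero.2 (Ne.symm hμ1)
  rw [(timeShear_pressure hrate hcont hmild hdiv hpol ht hslope hμd hμ1 x hb).1]
  field_simp
  ring

end Summit.NavierStokesRegularity.NavierStokesRegularity.Theorems.PoloidalWindowDoorPoloidalWindowRigidityTimeShearPressure

end
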